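import Summits.KontsevichZagierPeriods.Zeta5Search.Barrier.ConeGammaCritFarCert

/-!
# ζ(5) search — BARRIER: THE FAR CRITICAL POINT THROUGH INFINITY — `γ ≤ γ_box` for the regular directions of a box

HONEST FRAMING (cell `pub-zeta5`): systematic search; no irrationality claim unless kernel-certified. MODEL objects under
Brown–Zudilin's (28)+(30) accounting ([BZ22] = arXiv:2210.03391; (28) observed, not proved). From `critFarCheck`
(`ConeGammaCritFarCert.bounds_aOfS_of_critFarCheck`: `C₁ ≤ c₁⁺`, `c₀⁻ ≤ C₀`, `C₀ < C₁` under `Regular`), g37's integer test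
`CritBox.gammaCheck`, a box Φ-bound of the shape of cert-2 g36's `phi30_le_boxB_*` and the 5-set minorant
`CritBox.delta5Lower_le`, the tree's `gamma_le_of_bounds` gives **`gamma_le_of_critFarCheck : … → BZBox a → (box) →
Regular a → gamma a ≤ gnum/gden`** — the box hypothesis AND `Regular a` explicit; an UPPER bound over the box; nothing
about the cone's supremum (C2 OPEN), S-E (CONJECTURED), (TD_A) or `ζ(5)`. Theory seat cert-2 g38.
-/

noncomputable section

open Set

namespace Summit.KontsevichZagierPeriods.Zeta5Search.Barrier.ConeGamma

namespace CritFar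

open Literature.Analysis.ValidatedNumerics (AForm)
open Literature.Analysis.ValidatedNumerics.AForm
open LemmaFBox (SC SC_pos)
open CritBox

/-! ### `γ` on the box (for regular directions) -/

/-- **`γ ≤ γ_box` FOR EVERY REGULAR DIRECTION OF THE BOX.** From `critFarCheck`, g37's assembled integer test
`gammaCheck` (with `c0lo`, `c1hi`), and a box bound `Φ ≤ s₀·p/q` of the stated shape (cert-2 g36's
`phi30_le_boxB_*`), the tree's `gamma_le_of_bounds` gives `gamma a ≤ gnum/gden`. -/
theorem gamma_le_of_critFarCheck {D T : ℕ} {lo hi : List ℕ} {r0 r2 : RootData} {fd : FarData}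
    {c0lo c0hi c1hi : ℤ} {den : ℕ} (hc : critFarCheck D T lo hi r0 r2 fd c0lo c0hi c1hi den = true)
    {s5 : Fin 5 → Fin 28} {p : ℤ} {q gnum gden : ℕ}
    (hg : gammaCheck D lo hi s5 c0lo c1hi den p q gnum gden = true)
    (hΦ : ∀ a : Dir, BZBox a →
      (∀ j : Fin 7, ((lo.getD j.succ 0 : ℕ) : ℝ) ≤ sParam a j.succ / sParam a 0 * D ∧
        sParam a j.succ / sParam a 0 * D ≤ ((hi.getD j.succ 0 : ℕ) : ℝ)) → phi30 a ≤ sParam a 0 * ((p : ℝ) / q))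
    {a : Dir} (ha : BZBox a)
    (hbox : ∀ j : Fin 7, ((lo.getD j.succ 0 : ℕ) : ℝ) ≤ sParam a j.succ / sParam a 0 * D ∧
      sParam a j.succ / sParam a 0 * D ≤ ((hi.getD j.succ 0 : ℕ) : ℝ)) (hreg : Regular a) :
    gamma a ≤ (gnum : ℝ) / gden := by
  have hok := boxOKc_of_critFarCheck hc
  simp only [gammaCheck, decide_eq_true_eq] at hg
  obtain ⟨hinj, hden, hq, hD, hgden, hμ, hQ, hγ⟩ := hg
  obtain ⟨hmem, ht0⟩ := normalise_mem_box hok ha hbox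
  set t : Fin 8 → ℝ := fun i => sParam a i / sParam a 0 with ht
  have hs0 : 0 < sParam a 0 := ha.1
  have hn := LemmaFBox.aOfS_normalise ha
  have hregt : Regular (aOfS t) := by
    have eR : Regular a ↔ Regular (aOfS t) := by
      conv_lhs => rw [hn]
      exact regular_smul hs0 _
    exact eR.1 hreg
  obtain ⟨hC1, hC0, _, hlt⟩ := bounds_aOfS_of_critFarCheck hc hmem ht0 hregt
  have hopen := openBox_of_box hok hmem ht0
  have hBZ : BZBox (aOfS t) := by
    refine ⟨by rw [sParam_aOfS, ht0]; exact one_pos, fun j => ⟨?_, ?_⟩⟩ <;> rw [sParam_aOfS]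
    · exact (hopen j).1.le
    · exact (hopen j).2.le
  have hΦt : phi30 (aOfS t) ≤ (p : ℝ) / q := by
    have := hΦ (aOfS t) hBZ (fun j => by
      simp only [sParam_aOfS, ht0, div_one]
      exact ⟨(hmem j.succ).1, (hmem j.succ).2⟩)
    simpa only [sParam_aOfS, ht0, one_mul] using this
  have hδ := delta5Lower_le hD hmem hinj
  have hden' : (0 : ℝ) < den := by exact_mod_cast hden
  have hq' : (0 : ℝ) < q := by exact_mod_cast hq
  have hD' : (0 : ℝ) < D := by exact_mod_cast hD
  have hgden' : (0 : ℝ) < gden := by exact_mod_cast hgden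
  have hμ' : (0 : ℝ) ≤ (c0lo : ℝ) / den + (delta5Lower lo hi s5 : ℝ) / D - (p : ℝ) / q := by
    have : (0 : ℝ) ≤ (c0lo : ℝ) * D * q + (delta5Lower lo hi s5 : ℝ) * den * q - p * den * D := by
      have h' := (Int.cast_le (R := ℝ)).mpr hμ; push_cast at h'; linarith
    have e : (c0lo : ℝ) / den + (delta5Lower lo hi s5 : ℝ) / D - (p : ℝ) / q
        = ((c0lo : ℝ) * D * q + (delta5Lower lo hi s5 : ℝ) * den * q - p * den * D) / (den * D * q) := by
      field_simp
    rw [e]; exact div_nonneg this (by positivity)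
  have hQ' : (0 : ℝ) < (c1hi : ℝ) / den + (delta5Lower lo hi s5 : ℝ) / D - (p : ℝ) / q := by
    have : (0 : ℝ) < (c1hi : ℝ) * D * q + (delta5Lower lo hi s5 : ℝ) * den * q - p * den * D := by
      have h' := (Int.cast_lt (R := ℝ)).mpr hQ; push_cast at h'; linarith
    have e : (c1hi : ℝ) / den + (delta5Lower lo hi s5 : ℝ) / D - (p : ℝ) / q
        = ((c1hi : ℝ) * D * q + (delta5Lower lo hi s5 : ℝ) * den * q - p * den * D) / (den * D * q) := by
      field_simp
    rw [e]; exact div_pos this (by positivity)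
  have hγ' : ((c1hi : ℝ) / den - (c0lo : ℝ) / den) * gden
      ≤ gnum * ((c1hi : ℝ) / den + (delta5Lower lo hi s5 : ℝ) / D - (p : ℝ) / q) := by
    have : ((c1hi : ℝ) * D * q - c0lo * D * q) * gden
        ≤ gnum * ((c1hi : ℝ) * D * q + (delta5Lower lo hi s5 : ℝ) * den * q - p * den * D) := by
      have h' := (Int.cast_le (R := ℝ)).mpr hγ; push_cast at h'; linarith
    have e1 : ((c1hi : ℝ) / den - (c0lo : ℝ) / den) * gden
        = (((c1hi : ℝ) * D * q - c0lo * D * q) * gden) / (den * D * q) := by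
      field_simp
    have e2 : (gnum : ℝ) * ((c1hi : ℝ) / den + (delta5Lower lo hi s5 : ℝ) / D - (p : ℝ) / q)
        = (gnum * ((c1hi : ℝ) * D * q + (delta5Lower lo hi s5 : ℝ) * den * q - p * den * D)) / (den * D * q) := by
      field_simp
    rw [e1, e2]
    exact div_le_div_of_nonneg_right this (by positivity)
  have hQt : 0 < C1 (aOfS t) + (delta5Lower lo hi s5 : ℝ) / D - (p : ℝ) / q := by linarith
  have hgam := gamma_le_of_bounds hregt hC1 hC0 hδ hΦt hQt hμ'
  have eg : gamma a = gamma (aOfS t) := by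
    conv_lhs => rw [hn]
    exact gamma_smul hs0 _
  rw [eg]
  refine hgam.trans ?_
  rw [div_le_div_iff₀ hQ' hgden']
  exact hγ'

end CritFar

end Summit.KontsevichZagierPeriods.Zeta5Search.Barrier.ConeGamma

end
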